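import Summits.HodgeConjecture.HodgeConjecture.Theorems.K2E1bUnitaryDualOfParts           -- ★ Q12 p857054: `UnitarityDescendsStmt` (the socket's statement name)
import Summits.HodgeConjecture.HodgeConjecture.Theorems.K2E1bDatumCubicScalar            -- ★ 8b-β part 1 p857081: `upqLieC_σOfRecord_single` (twist dictionary)
import Summits.HodgeConjecture.HodgeConjecture.Theorems.K2E1bTwistHermitian              -- ★ U0 #8: `conj_twistScalar` (the forward direction `twistHermitian` lives here)
import Literature.NumberTheory.Automorphic.GKInfinitesimallyUnitaryConverse              -- ★ `isInfUnitary_of_isInfUnitaryAlongP`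
import HarnessLib

/-!
# K2 ∕ E1b unit U8, brick 8b-δ `K2E1bUnitarityDescends`: UNITARITY DESCENDS TO THE DATUM — a coh-unitary `(𝔤, K)`-module that is
# `(𝔤, K)`-equivalent to the structure of record of a Kovačević datum makes the datum unitarizable in Kovačević's sense

HCML Track B «K2-LIT», cell `hodgecm-mathlib`, crux H413 = stmt-HodgeConjecture-24833 (supports-only helper; closes nothing by itself).  Brick **8b-δ**
of socket 8b (`UnitaryDualWith`, TABLE `Lines/K2_E1b_GKCohomologyU21_U8_ArchPacketSigns.md` ED. 9 §2d); DEAL K2E1b-plan (g4) → K2E4-p10 (g3)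
2026-09-04T03:49:16Z.  HEAD `unitarityDescends : U8.UnitarityDescendsStmt` — the ★ Q12 statement name itself (`Theorems/K2E1bUnitaryDualOfParts.lean`),
so U8d pays `sig_K2E1bUnitarityDescends := K2E1bUnitarityDescends.unitarityDescends` BY NAME.  THEOREMS ONLY (no `def`, no `sorry`, no instance
declaration — one `attribute [local instance] LieRing.ofAssociativeRing`, Mathlib's own idiom —, no notation).

## The statement (★ `UnitarityDescendsStmt`)

For every irreducible `(𝔤, K)`-module `r` of `U(2,1)`, every datum `𝒟` and `e : ℤ` with the structure of record `(ρKOfRecord 𝒟 e, σOfRecord 𝒟 e)` a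
`(𝔤, K)`-module and irreducible: if `r` is coh-unitary (★ `IsCohUnitaryIrrep`: unitary along `𝔭 ⊕ ℝz₀`) and `[r] = [record of 𝒟 at e]` in ★ `GKIrrClass`,
then `𝒟` is unitarizable (★ `SU21Datum.IsUnitarizable`: a positive-definite Hermitian `B` with `B(E_{ij}v, w) = ε_iε_j B(v, E_{ji}w)`, `ε = (1,1,−1)`).

## The proof — the converse of ★ `twistHermitian`

1. `r` unitary along `𝔭 ⊕ ℝz₀` ⇒ Borel–Wallach unitary (★ `isInfUnitary_of_isInfUnitaryAlongP`: ALL of `𝔲(2,1)` is skew for a positive-definite Hermitian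
   `H`), i.e. ★ `HasInvariantHermitianForm r.ρ𝔤` (§3).
2. TRANSPORT along the `(𝔤, K)`-equivalence given by ★ `GKIrrClass.mk_eq_mk_iff` (`hasInvariantHermitianForm_of_gkEquiv`, §3: pull `H` back by `e⁻¹`).
3. COMPLEXIFICATION (§1, generic `U(α, β)`): for an invariant Hermitian `H`, `H(ρ_ℂ(M)v, w) = −H(v, ρ_ℂ(θM)w)` with `θM = −D Mᴴ D` (★ `upqTheta`; `Re θM = Re M`,
   `Im θM = −Im M`, ★ `upqRePart_upqTheta` ∕ `upqImPart_upqTheta`), and `θ(E_{ab}) = −d_a d_b E_{ba}` (`upqTheta_single`, `d = (1_α ∣ −1_β)`).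
4. DESCENT (§2): with the twist dictionary ★ `upqLieC_σOfRecord_single` (`ρ_ℂ(E_{ab}) = ρ(E_{ãb̃}) + δ_{ab}(e∕3)·1`) step 3 reads
   `H(ρ(E_{ij})v, w) + δ conj(e∕3) H(v,w) = ε_iε_j (H(v, ρ(E_{ji})w) + δ (e∕3) H(v,w))`; off the diagonal `δ = 0`, on it `ε_i² = 1` and `e∕3` is real —
   Kovačević's sign-skewness (`isUnitarizable_of_hasInvariantHermitianForm_σOfRecord`), ★ `signForm_entry_finSumFinEquiv_symm` turning `d` into ★ `suSign`.

Sources: [BorelWallach2000] 0 §2.5, VI Thm. 4.12 (2); [Kovacevic2021] §2, §4 Thm. 4; [KnappVogan1995] §II.4; [Knapp2002] VI §2; [Rogawski1990] §12.3 p. 177.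
HONEST LABEL: 8b-δ pays one named input of socket 8b; it closes nothing at rung 0 by itself; HC_CM is proved only modulo the 7 printed citations
(2 remaining named inputs: hLiu418 = stmt-HodgeConjecture-24832, h413 = stmt-HodgeConjecture-24833) until rung 0 closes.
-/

set_option autoImplicit false
set_option linter.dupNamespace false

noncomputable section

open scoped ComplexConjugate

namespace Summit.HodgeConjecture.HodgeConjecture.Cruxes.H413.K2E1bUnitarityDescends

open Literature.NumberTheory.Automorphic
open Literature.RepresentationTheory
open Literature.RepresentationTheory.BorelWallach2000
open Literature.RepresentationTheory.KonnoKonno2007 Literature.RepresentationTheory.KonnoKonno2007.RealDualPair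
open Literature.RepresentationTheory.KonnoKonno2007.RealDualPair.UForm
open Literature.RepresentationTheory.Kovacevic2021 Literature.RepresentationTheory.Kovacevic2021.SU21Datum
open Summit.HodgeConjecture.HodgeConjecture.Cruxes.H413.F0P3bLocalAPacketsDefs
open Summit.HodgeConjecture.HodgeConjecture.Cruxes.H413.F0P3bU21Restriction
open Summit.HodgeConjecture.HodgeConjecture.Cruxes.H413.F0P3bArchDegOnePackage (IsCohUnitaryIrrep)
open Summit.HodgeConjecture.HodgeConjecture.Cruxes.H413.K2E1bGKCohomologyU21
open Summit.HodgeConjecture.HodgeConjecture.Cruxes.H413.K2E1bCarriersOfRecord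
open Summit.HodgeConjecture.HodgeConjecture.Cruxes.H413.K2E1bDatumCubicScalar

-- Mathlib idiom (Mathlib/Algebra/Lie/OfAssociative.lean): commutator brackets on associative algebras; needed to MENTION `ρ𝔤 : 𝔲(α,β) →ₗ⁅ℝ⁆ End V`,
-- `σOfRecord 𝒟 e` and the `𝔤𝔩(3,ℂ)`-module `𝒟.V`, exactly as in ★ `K2E1bUnitaryDualOfParts`, ★ `K2E1bTwistHermitian` and every ★ Kovačević file.
attribute [local instance 100] LieRing.ofAssociativeRing

/-! ## §1 Complexification of an invariant Hermitian form (generic `U(α, β)`) -/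

section General

variable {α β : Type} [Fintype α] [DecidableEq α] [Fintype β] [DecidableEq β]
variable {V : Type*} [AddCommGroup V] [Module ℂ V] (ρ𝔤 : (uFormGroup α β).lie →ₗ⁅ℝ⁆ Module.End ℂ V)

/-- **An invariant Hermitian form and the complexified action**: if every `ρ𝔤(X)`, `X ∈ 𝔲(α, β)`, is `H`-skew (`H` conjugate-linear in the first
variable), then `H(ρ_ℂ(M) v, w) = −H(v, ρ_ℂ(θM) w)` for every complex `M`, `θM = −D Mᴴ D` (★ `upqTheta`): `ρ_ℂ(M) = ρ𝔤(Re M) + i ρ𝔤(Im M)`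
(★ `upqLieC_apply`), `Re θM = Re M`, `Im θM = −Im M`, `conj i = −i`. [cite: Knapp2002, VI §2] [cite: KnappVogan1995, §IV.1] -/
theorem form_upqLieC_eq_neg_upqTheta (H : V →ₗ⋆[ℂ] V →ₗ[ℂ] ℂ)
    (hskew : ∀ (X : (uFormGroup α β).lie) (v w : V), H (ρ𝔤 X v) w = -H v (ρ𝔤 X w))
    (M : Matrix (α ⊕ β) (α ⊕ β) ℂ) (v w : V) :
    H (upqLieC ρ𝔤 M v) w = -H v (upqLieC ρ𝔤 (upqTheta α β M) w) := by
  rw [upqLieC_apply, upqLieC_apply, upqRePart_upqTheta, upqImPart_upqTheta, map_neg, LinearMap.add_apply,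
    LinearMap.add_apply, LinearMap.smul_apply, LinearMap.smul_apply, LinearMap.neg_apply, map_add, LinearMap.add_apply,
    LinearMap.map_smulₛₗ, LinearMap.smul_apply, map_add, map_smul, map_neg, hskew, hskew, Complex.conj_I, smul_eq_mul, smul_eq_mul]
  ring

/-- **`θ` on the matrix units**: `θ(E_{ab}) = −d_a d_b · E_{ba}` with `d = (1_α ∣ −1_β)` the diagonal of `D` (★ `signForm_eq_diagonal`).
[cite: Knapp2002, VI §2] [cite: Kovacevic2021, §2] -/
theorem upqTheta_single (a b : α ⊕ β) :
    upqTheta α β (Matrix.single a b (1 : ℂ)) =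
      -((Sum.elim (fun _ : α => (1 : ℂ)) (fun _ : β => -1) a * Sum.elim (fun _ : α => (1 : ℂ)) (fun _ : β => -1) b) •
        Matrix.single b a (1 : ℂ)) := by
  rw [upqTheta_apply, signForm_eq_diagonal, Matrix.conjTranspose_single, star_one]
  congr 1
  ext i j
  rw [Matrix.mul_diagonal, Matrix.diagonal_mul, Matrix.smul_apply, Matrix.single_apply, smul_eq_mul]
  split_ifs with h
  · obtain ⟨rfl, rfl⟩ := h
    ring
  · ring

end General

/-! ## §2 Descent: an invariant Hermitian form for the structure of record makes the datum unitarizable -/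

/-- **CONVERSE OF ★ `twistHermitian`.**  If the central twist of record `σOfRecord 𝒟 e` (★ #23) admits an invariant positive-definite Hermitian form
(★ `HasInvariantHermitianForm`: every `σ(X)`, `X ∈ 𝔲(2,1)`, skew), then the datum is unitarizable in Kovačević's sense (★ `IsUnitarizable`:
`H(E_{ij}v, w) = ε_iε_j H(v, E_{ji}w)`, `ε = (1, 1, −1)`): by §1 with `M = E_{ab}` and the twist dictionary ★ `upqLieC_σOfRecord_single`
(`ρ_ℂ(E_{ab}) = ρ(E_{ãb̃}) + δ_{ab}(e∕3)·1`), the scalar `e∕3` being REAL (so it cancels on the diagonal) and `θ(E_{ab}) = −d_ad_b E_{ba}`.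
[cite: Kovacevic2021, §4 Thm. 4] [cite: BorelWallach2000, VI Thm. 4.12 (2)] -/
theorem isUnitarizable_of_hasInvariantHermitianForm_σOfRecord (𝒟 : SU21Datum) (e : ℤ)
    (h : HasInvariantHermitianForm (σOfRecord 𝒟 e)) : IsUnitarizable 𝒟 := by
  obtain ⟨H, hH, hpos, hskew⟩ := h
  refine ⟨H, hH, hpos, fun i j v w => ?_⟩
  -- pull the indices back along `Fin 2 ⊕ Fin 1 ≃ Fin 3`
  obtain ⟨a, rfl⟩ := (finSumFinEquiv : Fin 2 ⊕ Fin 1 ≃ Fin 3).surjective i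
  obtain ⟨b, rfl⟩ := (finSumFinEquiv : Fin 2 ⊕ Fin 1 ≃ Fin 3).surjective j
  have hsign : ∀ c : Fin 2 ⊕ Fin 1, suSign ((finSumFinEquiv : Fin 2 ⊕ Fin 1 ≃ Fin 3) c) =
      Sum.elim (fun _ : Fin 2 => (1 : ℂ)) (fun _ : Fin 1 => -1) c := fun c => by
    rw [suSign, ← signForm_entry_finSumFinEquiv_symm ((finSumFinEquiv : Fin 2 ⊕ Fin 1 ≃ Fin 3) c), Equiv.symm_apply_apply]
  have hd : ∀ c : Fin 2 ⊕ Fin 1,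
      Sum.elim (fun _ : Fin 2 => (1 : ℂ)) (fun _ : Fin 1 => -1) c * Sum.elim (fun _ : Fin 2 => (1 : ℂ)) (fun _ : Fin 1 => -1) c = 1 := by
    rintro (c | c) <;> simp
  have hz : conj ((e : ℂ) / 3) = (e : ℂ) / 3 := by rw [map_div₀, map_intCast, map_ofNat]
  -- §1 at `M = E_{ab}`, rewritten through the twist dictionary and `θ(E_{ab}) = −d_a d_b E_{ba}`
  have key := form_upqLieC_eq_neg_upqTheta (σOfRecord 𝒟 e) H hskew (Matrix.single a b (1 : ℂ)) v w
  rw [upqTheta_single, map_neg, map_smul, upqLieC_σOfRecord_single, upqLieC_σOfRecord_single] at key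
  simp only [LinearMap.neg_apply, LinearMap.smul_apply, LinearMap.add_apply, Module.End.one_apply, map_neg, map_smul, map_add,
    LinearMap.map_smulₛₗ, smul_eq_mul, neg_neg] at key
  rw [lie_def, lie_def, hsign, hsign]
  by_cases hab : a = b
  · subst hab
    simp only [if_true, hd, one_mul, hz] at key ⊢
    linear_combination key
  · simp only [if_neg hab, if_neg (Ne.symm hab), map_zero, zero_mul, add_zero] at key
    linear_combination key

/-! ## §3 Invariant Hermitian forms: from coh-unitarity, and transport along a `(𝔤, K)`-equivalence -/

/-- **Coh-unitary ⇒ invariant Hermitian form.**  An irreducible `(𝔤, K)`-module of `U(2,1)` that is unitary along `𝔭 ⊕ ℝz₀` (★ `IsCohUnitaryIrrep`, whose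
clause `unit` IS ★ `IsInfUnitaryAlongP` token for token) is Borel–Wallach unitary (★ `isInfUnitary_of_isInfUnitaryAlongP`: all of `𝔲(2,1)` skew for a
positive-definite Hermitian form), in particular ★ `HasInvariantHermitianForm r.ρ𝔤`. [cite: BorelWallach2000, 0 §2.5] [cite: KnappVogan1995, §I.4 (1.64)–(1.65)] -/
theorem hasInvariantHermitianForm_of_isCohUnitaryIrrep (r : GKIrrep G21) (hcoh : IsCohUnitaryIrrep r.ρK r.ρ𝔤) :
    HasInvariantHermitianForm r.ρ𝔤 := by
  obtain ⟨H, hH, hpos, hskew, -⟩ := isInfUnitary_of_isInfUnitaryAlongP hcoh.gk hcoh.unit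
  exact ⟨H, hH, hpos, hskew⟩

/-- **Transport of an invariant Hermitian form along a `(𝔤, K)`-equivalence** (pull back by the inverse: `H′(v, w) = H(e⁻¹v, e⁻¹w)`; the inverse intertwines
the `𝔤`-actions, ★ `intertwines_symm` pattern). [cite: KnappVogan1995, §II.4] [cite: BorelWallach2000, I §4.3] -/
theorem hasInvariantHermitianForm_of_gkEquiv {V W : Type} [AddCommGroup V] [Module ℂ V] [AddCommGroup W] [Module ℂ W]
    {ρK : Representation ℂ G21.maximalCompact V} {ρ𝔤 : G21.lie →ₗ⁅ℝ⁆ Module.End ℂ V}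
    {σK : Representation ℂ G21.maximalCompact W} {σ𝔤 : G21.lie →ₗ⁅ℝ⁆ Module.End ℂ W}
    (eqv : GKEquiv ρK ρ𝔤 σK σ𝔤) (h : HasInvariantHermitianForm ρ𝔤) : HasInvariantHermitianForm σ𝔤 := by
  obtain ⟨H, hH, hpos, hskew⟩ := h
  let g : W →ₗ[ℂ] V := (eqv.toLinearEquiv.symm : W →ₗ[ℂ] V)
  have hg : ∀ (X : G21.lie) (w : W), g (σ𝔤 X w) = ρ𝔤 X (g w) := fun X w =>
    eqv.toLinearEquiv.injective (by
      change eqv.toLinearEquiv (eqv.toLinearEquiv.symm (σ𝔤 X w)) = eqv.toLinearEquiv (ρ𝔤 X (eqv.toLinearEquiv.symm w))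
      rw [LinearEquiv.apply_symm_apply, eqv.map_ρ𝔤, LinearEquiv.apply_symm_apply])
  have hinj : Function.Injective g := eqv.toLinearEquiv.symm.injective
  have happ : ∀ v w, (H.comp g).compl₂ g v w = H (g v) (g w) := fun v w => rfl
  refine ⟨(H.comp g).compl₂ g, fun v w => ?_, fun v hv => ?_, fun X v w => ?_⟩
  · rw [happ, happ]; exact hH (g v) (g w)
  · rw [happ]; exact hpos (g v) fun h0 => hv (hinj (by rw [h0, map_zero]))
  · rw [happ, happ, hg, hg]; exact hskew X (g v) (g w)

/-! ## §4 The head -/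

/-- **UNITARITY DESCENDS TO THE DATUM** (unfolded binders).  A coh-unitary irreducible `(𝔤, K)`-module `(𝔤, K)`-equivalent to the structure of record of
`𝒟` at `e` makes `𝒟` unitarizable: §3 (invariant Hermitian form on `r`, transported to `(ρKOfRecord 𝒟 e, σOfRecord 𝒟 e)` along ★ `GKIrrClass.mk_eq_mk_iff`)
and §2 (descent). [cite: BorelWallach2000, VI Thm. 4.12 (2)] [cite: Kovacevic2021, §4 Thm. 4] [cite: KnappVogan1995, §II.4] -/
theorem isUnitarizable_of_mk_eq_mk (r : GKIrrep G21) (𝒟 : SU21Datum) (e : ℤ)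
    (hGK : IsGKModule G21 (ρKOfRecord 𝒟 e) (σOfRecord 𝒟 e)) (hirr : IsIrreducibleGK (ρKOfRecord 𝒟 e) (σOfRecord 𝒟 e))
    (hcoh : IsCohUnitaryIrrep r.ρK r.ρ𝔤)
    (hmk : GKIrrClass.mk r = GKIrrClass.mk ⟨𝒟.V, ρKOfRecord 𝒟 e, σOfRecord 𝒟 e, hGK, hirr⟩) : IsUnitarizable 𝒟 := by
  obtain ⟨eqv⟩ := (GKIrrClass.mk_eq_mk_iff r ⟨𝒟.V, ρKOfRecord 𝒟 e, σOfRecord 𝒟 e, hGK, hirr⟩).1 hmk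
  exact isUnitarizable_of_hasInvariantHermitianForm_σOfRecord 𝒟 e
    (hasInvariantHermitianForm_of_gkEquiv eqv (hasInvariantHermitianForm_of_isCohUnitaryIrrep r hcoh))

/-- **8b-δ — HEAD, BY NAME**: ★ `UnitarityDescendsStmt` (Q12 `K2E1bUnitaryDualOfParts`) holds; U8d pays `sig_K2E1bUnitarityDescends := unitarityDescends`.
[cite: BorelWallach2000, VI Thm. 4.12 (2)] [cite: Kovacevic2021, §4 Thm. 4] -/
theorem unitarityDescends : U8.UnitarityDescendsStmt :=
  fun r 𝒟 e hGK hirr hcoh hmk => isUnitarizable_of_mk_eq_mk r 𝒟 e hGK hirr hcoh hmk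

end Summit.HodgeConjecture.HodgeConjecture.Cruxes.H413.K2E1bUnitarityDescends

end
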